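import Literature.Geometry.Riemannian.MetricFlowCorrespondenceGlue
import Literature.Geometry.Riemannian.GromovW1Triangle
import Literature.Geometry.Riemannian.MetricFlowWassersteinMonotoneGeneral
import HarnessLib

/-!
# The triangle inequality of the `𝔽`-distance (Bamler 2023, §5.2, Thm. 5.13, via Prop. 5.14
# and Lemma 5.15), for `H`-concentrated metric flow pairs

R. Bamler, *Compactness theory of the space of super Ricci flows*, Invent. Math. 233 (2023), §5.2:
Theorem 5.13 (arXiv v1 Thm. 112): `(𝔽^J_I, d^J_𝔽)` is a metric space; the triangle inequality is
Proposition 5.14 (arXiv v1 Prop. 113: within one correspondence,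
`d^{ℭ,J}_𝔽(1, 3) ≤ d^{ℭ,J}_𝔽(1, 2) + d^{ℭ,J}_𝔽(2, 3)` — glue the couplings `q¹²_t`, `q²³_t` along `μ²_t`,
take `E¹³ := E¹² ∪ E²³` and integrate the `W₁`-triangle inequality in `Z_s`) combined with
Lemma 5.15 (arXiv v1 Lemma 114: two correspondences `ℭ¹²`, `ℭ²³` combine into one by metric
gluing along `𝒳²`, `MetricFlowCorrespondenceGlue.lean`).

This file proves, for the tree's `MetricFlowPair.fDist` (`MetricFlowFDistance.lean`):

* `kernelDistWithin_le_add_edist`, `continuous_kernelDistWithin`, `measurable_kernelDistWithin` —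
  for `H`-concentrated flows the integrand
  `(x¹, x²) ↦ d^{Z_s}_{W₁}((φ¹_s)_* ν¹_{x¹;s}, (φ²_s)_* ν²_{x²;s})` of Definition (𝔽-distance within
  correspondence) is `2`-Lipschitz on `𝒳¹_t × 𝒳²_t`, hence continuous and Borel measurable
  (`d_{W₁}(ν_{x;s}, ν_{y;s}) ≤ d_t(x, y)`, Bamler 2023 §3.2 Prop. (c), and the triangle
  inequality for `d_{W₁}` between push-forwards of measures on the Polish slices,
  `wassersteinW1_map_triangle`);
* `kernelDistWithin_glue_le` — the pointwise estimate in the glued correspondence,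
  `d^{Z_s}_{W₁}((φ¹_s)_* ν¹_{a;s}, (φ³_s)_* ν³_{c;s}) ≤ d^{Z¹²_s}_{W₁}((φ^{12,1}_s)_* ν¹_{a;s},
  (φ^{12,2}_s)_* ν²_{b;s}) + d^{Z²³_s}_{W₁}((φ^{23,2}_s)_* ν²_{b;s}, (φ^{23,3}_s)_* ν³_{c;s})`;
* `FDistAdmissible.trans` — **Prop. 5.14**: admissible radii add under gluing,
  `r¹² + r²³` is admissible for `d^{ℭ¹².glue ℭ²³, J}_𝔽(1, 3)` (couplings glued on the slices by
  `IsCoupling.exists_glue`, `E¹³ := E¹² ∪ E²³`);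
* `fDist_triangle` — **Thm. 5.13, triangle inequality**:
  `d^J_𝔽(𝒳¹, 𝒳³) ≤ d^J_𝔽(𝒳¹, 𝒳²) + d^J_𝔽(𝒳², 𝒳³)` for `H`-concentrated metric flow pairs over a
  common `I`.

Design point. The vendored `FDistAdmissible` integrates the integrand with a LOWER Lebesgue
integral `∫⁻ … ∂q_t` and does not require its measurability; the integration step of Prop. 5.14
(`∫ (f¹² ∘ π₁₂ + f²³ ∘ π₂₃) dγ = ∫ f¹² dq¹² + ∫ f²³ dq²³` for the glued coupling `γ`) needs the
integrands to be measurable (lower integrals are only super-additive). For `H`-concentrated flows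
— the standing assumption of Bamler's compactness theory — the integrand is Borel
(`measurable_kernelDistWithin`), which is why the three flows are assumed `H`-concentrated here.
What is NOT here: the general (not `H`-concentrated) case, which needs the weak lower
semicontinuity of the optimal transport cost on `𝒳¹_s × 𝒳²_s`, and the definiteness of `d^J_𝔽`
(§5.3).

## References

* R. H. Bamler, *Compactness theory of the space of super Ricci flows*, Invent. Math. 233 (2023),
  1121–1277 (arXiv:2008.09298), §5.1 Definitions; §5.2, Thm. 5.13, Prop. 5.14, Lemma 5.15
  (arXiv v1: Thm. 112, Prop. 113, Lemma 114); §3.2, Proposition (c). [Bamler2023]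
* C. Villani, *Topics in Optimal Transportation*, GSM 58 (AMS 2003), Lemma 7.6. [Villani2003]
-/

noncomputable section

open Set MeasureTheory Filter TopologicalSpace Function
open scoped Topology ENNReal NNReal

namespace Literature.Geometry.Riemannian

universe u

namespace MetricFlowPair

open MetricFlow

variable {I₁ I₂ I₃ : Set ℝ} {P₁ : MetricFlowPair.{u} I₁} {P₂ : MetricFlowPair.{u} I₂}
  {P₃ : MetricFlowPair.{u} I₃} {I'' : Set ℝ}

/-! ### The integrand is continuous for `H`-concentrated flows -/

/-- **The integrand of the `𝔽`-distance is `2`-Lipschitz for `H`-concentrated flows**: for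
`s ≤ t` in `I''^{,1} ∩ I''^{,2}` and `p, q ∈ 𝒳¹_t × 𝒳²_t`,
`d_{W₁}((φ¹_s)_* ν¹_{p₁;s}, (φ²_s)_* ν²_{p₂;s}) ≤ d_{W₁}((φ¹_s)_* ν¹_{q₁;s}, (φ²_s)_* ν²_{q₂;s}) +
2 d(p, q)`: the triangle inequality for `d_{W₁}` between push-forwards of measures on the Polish
slices under the isometric embeddings `φ^i_s` (`wassersteinW1_map_triangle`), the monotonicity of
`d_{W₁}` under `φ^i_s` and `d_{W₁}(ν_{x;s}, ν_{y;s}) ≤ d_t(x, y)` (Bamler 2023, §3.2,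
Proposition (c), `IsHConcentrated.wassersteinW1_condKernel_le_edist`).
[cite: Bamler2023, §5.1, Definition (F-distance within correspondence); §3.2, Proposition (c)] -/
theorem kernelDistWithin_le_add_edist {H₁ H₂ : ℝ} (hH₁ : P₁.flow.IsHConcentrated H₁)
    (hH₂ : P₂.flow.IsHConcentrated H₂) (ℭ : Correspondence₂ P₁.flow P₂.flow I'') {s t : ℝ}
    (hs₁ : s ∈ ℭ.dom₁) (hs₂ : s ∈ ℭ.dom₂) (ht₁ : t ∈ ℭ.dom₁) (ht₂ : t ∈ ℭ.dom₂) (hst : s ≤ t)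
    (p q : P₁.flow.Slice ⟨t, (ℭ.dom₁_subset ht₁).1⟩ × P₂.flow.Slice ⟨t, (ℭ.dom₂_subset ht₂).1⟩) :
    kernelDistWithin P₁ P₂ ℭ hs₁ hs₂ ht₁ ht₂ p ≤
      kernelDistWithin P₁ P₂ ℭ hs₁ hs₂ ht₁ ht₂ q + 2 * edist p q := by
  haveI := P₁.flow.isProbabilityMeasure_condKernel (s := ⟨s, (ℭ.dom₁_subset hs₁).1⟩) p.1 hst
  haveI := P₁.flow.isProbabilityMeasure_condKernel (s := ⟨s, (ℭ.dom₁_subset hs₁).1⟩) q.1 hst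
  haveI := P₂.flow.isProbabilityMeasure_condKernel (s := ⟨s, (ℭ.dom₂_subset hs₂).1⟩) p.2 hst
  haveI := P₂.flow.isProbabilityMeasure_condKernel (s := ⟨s, (ℭ.dom₂_subset hs₂).1⟩) q.2 hst
  have hφ₁ := ℭ.isometry₁ s hs₁
  have hφ₂ := ℭ.isometry₂ s hs₂
  have hφ₁m : Measurable (ℭ.φ₁ s hs₁) := hφ₁.continuous.measurable
  have hφ₂m : Measurable (ℭ.φ₂ s hs₂) := hφ₂.continuous.measurable
  -- the two `W₁`-triangle inequalities in `Z_s`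
  have h1 := wassersteinW1_map_triangle hφ₁ hφ₁ hφ₂
    (P₁.flow.condKernel p.1 ⟨s, (ℭ.dom₁_subset hs₁).1⟩)
    (P₁.flow.condKernel q.1 ⟨s, (ℭ.dom₁_subset hs₁).1⟩)
    (P₂.flow.condKernel p.2 ⟨s, (ℭ.dom₂_subset hs₂).1⟩)
  have h2 := wassersteinW1_map_triangle hφ₁ hφ₂ hφ₂
    (P₁.flow.condKernel q.1 ⟨s, (ℭ.dom₁_subset hs₁).1⟩)
    (P₂.flow.condKernel q.2 ⟨s, (ℭ.dom₂_subset hs₂).1⟩)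
    (P₂.flow.condKernel p.2 ⟨s, (ℭ.dom₂_subset hs₂).1⟩)
  -- the two outer terms are at most `d_t`
  have e1 : wassersteinW1 ((P₁.flow.condKernel p.1 ⟨s, (ℭ.dom₁_subset hs₁).1⟩).map (ℭ.φ₁ s hs₁))
      ((P₁.flow.condKernel q.1 ⟨s, (ℭ.dom₁_subset hs₁).1⟩).map (ℭ.φ₁ s hs₁)) ≤ edist p q :=
    calc _ ≤ wassersteinW1 (P₁.flow.condKernel p.1 ⟨s, (ℭ.dom₁_subset hs₁).1⟩)
          (P₁.flow.condKernel q.1 ⟨s, (ℭ.dom₁_subset hs₁).1⟩) :=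
          wassersteinW1_map_le_of_edist_le hφ₁m (fun a b ↦ (hφ₁.edist_eq a b).le) _ _
      _ ≤ edist p.1 q.1 := hH₁.wassersteinW1_condKernel_le_edist hst p.1 q.1
      _ ≤ edist p q := by rw [Prod.edist_eq]; exact le_max_left _ _
  have e2 : wassersteinW1 ((P₂.flow.condKernel q.2 ⟨s, (ℭ.dom₂_subset hs₂).1⟩).map (ℭ.φ₂ s hs₂))
      ((P₂.flow.condKernel p.2 ⟨s, (ℭ.dom₂_subset hs₂).1⟩).map (ℭ.φ₂ s hs₂)) ≤ edist p q :=
    calc _ ≤ wassersteinW1 (P₂.flow.condKernel q.2 ⟨s, (ℭ.dom₂_subset hs₂).1⟩)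
          (P₂.flow.condKernel p.2 ⟨s, (ℭ.dom₂_subset hs₂).1⟩) :=
          wassersteinW1_map_le_of_edist_le hφ₂m (fun a b ↦ (hφ₂.edist_eq a b).le) _ _
      _ ≤ edist q.2 p.2 := hH₂.wassersteinW1_condKernel_le_edist hst q.2 p.2
      _ ≤ edist p q := by rw [edist_comm, Prod.edist_eq]; exact le_max_right _ _
  calc kernelDistWithin P₁ P₂ ℭ hs₁ hs₂ ht₁ ht₂ p
      ≤ _ := h1
    _ ≤ edist p q + (kernelDistWithin P₁ P₂ ℭ hs₁ hs₂ ht₁ ht₂ q + edist p q) :=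
        add_le_add e1 (h2.trans (add_le_add le_rfl e2))
    _ = kernelDistWithin P₁ P₂ ℭ hs₁ hs₂ ht₁ ht₂ q + 2 * edist p q := by rw [two_mul]; ring

/-- **The integrand of the `𝔽`-distance is continuous on `𝒳¹_t × 𝒳²_t`** for `H`-concentrated
flows (`continuous_of_le_add_edist`). [cite: Bamler2023, §5.1, Definition (F-distance within correspondence)] -/
theorem continuous_kernelDistWithin {H₁ H₂ : ℝ} (hH₁ : P₁.flow.IsHConcentrated H₁)
    (hH₂ : P₂.flow.IsHConcentrated H₂) (ℭ : Correspondence₂ P₁.flow P₂.flow I'') {s t : ℝ}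
    (hs₁ : s ∈ ℭ.dom₁) (hs₂ : s ∈ ℭ.dom₂) (ht₁ : t ∈ ℭ.dom₁) (ht₂ : t ∈ ℭ.dom₂) (hst : s ≤ t) :
    Continuous fun p ↦ kernelDistWithin P₁ P₂ ℭ hs₁ hs₂ ht₁ ht₂ p :=
  continuous_of_le_add_edist 2 (by simp) fun p q ↦
    kernelDistWithin_le_add_edist hH₁ hH₂ ℭ hs₁ hs₂ ht₁ ht₂ hst p q

/-- **The integrand of the `𝔽`-distance is Borel measurable on `𝒳¹_t × 𝒳²_t`** for
`H`-concentrated flows — the measurability needed to integrate the pointwise estimates of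
Prop. 5.14 against couplings (the vendored Definition uses a lower integral).
[cite: Bamler2023, §5.2, Prop. 5.14 (arXiv v1 Prop. 113), proof] -/
theorem measurable_kernelDistWithin {H₁ H₂ : ℝ} (hH₁ : P₁.flow.IsHConcentrated H₁)
    (hH₂ : P₂.flow.IsHConcentrated H₂) (ℭ : Correspondence₂ P₁.flow P₂.flow I'') {s t : ℝ}
    (hs₁ : s ∈ ℭ.dom₁) (hs₂ : s ∈ ℭ.dom₂) (ht₁ : t ∈ ℭ.dom₁) (ht₂ : t ∈ ℭ.dom₂) (hst : s ≤ t) :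
    Measurable fun p ↦ kernelDistWithin P₁ P₂ ℭ hs₁ hs₂ ht₁ ht₂ p :=
  (continuous_kernelDistWithin hH₁ hH₂ ℭ hs₁ hs₂ ht₁ ht₂ hst).measurable

/-! ### The pointwise estimate in the glued correspondence -/

/-- **The `W₁`-triangle inequality through the common copy of `𝒳²_s` in the glued correspondence**
(Bamler 2023, §5.2, proof of Prop. 5.14 inside the correspondence of Lemma 5.15): for
`s ≤ t` in all four domains and `a ∈ 𝒳¹_t`, `b ∈ 𝒳²_t`, `c ∈ 𝒳³_t`,
`d^{Z_s}_{W₁}((φ¹_s)_* ν¹_{a;s}, (φ³_s)_* ν³_{c;s}) ≤ d^{Z¹²_s}_{W₁}((φ^{12,1}_s)_* ν¹_{a;s},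
(φ^{12,2}_s)_* ν²_{b;s}) + d^{Z²³_s}_{W₁}((φ^{23,2}_s)_* ν²_{b;s}, (φ^{23,3}_s)_* ν³_{c;s})` — the
triangle inequality between the push-forwards in the glued space `Z_s`
(`wassersteinW1_map_triangle`, the middle measure embedded by the common copy
`inl ∘ φ^{12,2}_s = inr ∘ φ^{23,2}_s` of `𝒳²_s`) and the monotonicity of `d_{W₁}` under the isometric
embeddings `inl`, `inr` (`wassersteinW1_map_le_of_edist_le`).
[cite: Bamler2023, §5.2, Prop. 5.14 (arXiv v1 Prop. 113) and Lemma 5.15, proofs] -/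
theorem kernelDistWithin_glue_le (ℭ₁₂ : Correspondence₂ P₁.flow P₂.flow I'')
    (ℭ₂₃ : Correspondence₂ P₂.flow P₃.flow I'') {s t : ℝ} (hs₁ : s ∈ ℭ₁₂.dom₁) (hs₂ : s ∈ ℭ₁₂.dom₂)
    (hs₂' : s ∈ ℭ₂₃.dom₁) (hs₃ : s ∈ ℭ₂₃.dom₂) (ht₁ : t ∈ ℭ₁₂.dom₁) (ht₂ : t ∈ ℭ₁₂.dom₂)
    (ht₂' : t ∈ ℭ₂₃.dom₁) (ht₃ : t ∈ ℭ₂₃.dom₂) (hst : s ≤ t)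
    (a : P₁.flow.Slice ⟨t, (ℭ₁₂.dom₁_subset ht₁).1⟩) (b : P₂.flow.Slice ⟨t, (ℭ₁₂.dom₂_subset ht₂).1⟩)
    (c : P₃.flow.Slice ⟨t, (ℭ₂₃.dom₂_subset ht₃).1⟩) :
    kernelDistWithin P₁ P₃ (ℭ₁₂.glue ℭ₂₃) hs₁ hs₃ ht₁ ht₃ (a, c) ≤
      kernelDistWithin P₁ P₂ ℭ₁₂ hs₁ hs₂ ht₁ ht₂ (a, b) +
        kernelDistWithin P₂ P₃ ℭ₂₃ hs₂' hs₃ ht₂' ht₃ (b, c) := by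
  haveI := P₁.flow.isProbabilityMeasure_condKernel (s := ⟨s, (ℭ₁₂.dom₁_subset hs₁).1⟩) a hst
  haveI := P₂.flow.isProbabilityMeasure_condKernel (s := ⟨s, (ℭ₁₂.dom₂_subset hs₂).1⟩) b hst
  haveI := P₃.flow.isProbabilityMeasure_condKernel (s := ⟨s, (ℭ₂₃.dom₂_subset hs₃).1⟩) c hst
  -- the embeddings of `Z¹²_s`, `Z²³_s` into the glued space `Z_s`
  set G := Correspondence₂.gluedSpace ℭ₁₂ ℭ₂₃ ⟨s, (ℭ₁₂.dom₁_subset hs₁).2⟩ with hG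
  let L : ℭ₁₂.Z ⟨s, (ℭ₁₂.dom₁_subset hs₁).2⟩ → (ℭ₁₂.glue ℭ₂₃).Z ⟨s, (ℭ₁₂.dom₁_subset hs₁).2⟩ :=
    G.inl
  let R : ℭ₂₃.Z ⟨s, (ℭ₂₃.dom₂_subset hs₃).2⟩ → (ℭ₁₂.glue ℭ₂₃).Z ⟨s, (ℭ₁₂.dom₁_subset hs₁).2⟩ :=
    G.inr
  have hL : Isometry L := G.isometry_inl
  have hR : Isometry R := G.isometry_inr
  have hLm : Measurable L := hL.continuous.measurable
  have hRm : Measurable R := hR.continuous.measurable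
  have hφ₁ := ℭ₁₂.isometry₁ s hs₁
  have hφ₂ := ℭ₁₂.isometry₂ s hs₂
  have hψ₂ := ℭ₂₃.isometry₁ s hs₂'
  have hψ₃ := ℭ₂₃.isometry₂ s hs₃
  have hmid : L ∘ ℭ₁₂.φ₂ s hs₂ = R ∘ ℭ₂₃.φ₁ s hs₂' := funext fun x ↦ G.comm hs₂ hs₂' x
  -- notation for the three kernels
  set ν₁ := P₁.flow.condKernel a ⟨s, (ℭ₁₂.dom₁_subset hs₁).1⟩ with hν₁
  set ν₂ := P₂.flow.condKernel b ⟨s, (ℭ₁₂.dom₂_subset hs₂).1⟩ with hν₂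
  set ν₃ := P₃.flow.condKernel c ⟨s, (ℭ₂₃.dom₂_subset hs₃).1⟩ with hν₃
  calc kernelDistWithin P₁ P₃ (ℭ₁₂.glue ℭ₂₃) hs₁ hs₃ ht₁ ht₃ (a, c)
      = wassersteinW1 (ν₁.map (L ∘ ℭ₁₂.φ₁ s hs₁)) (ν₃.map (R ∘ ℭ₂₃.φ₂ s hs₃)) := rfl
    _ ≤ wassersteinW1 (ν₁.map (L ∘ ℭ₁₂.φ₁ s hs₁)) (ν₂.map (L ∘ ℭ₁₂.φ₂ s hs₂)) +
          wassersteinW1 (ν₂.map (L ∘ ℭ₁₂.φ₂ s hs₂)) (ν₃.map (R ∘ ℭ₂₃.φ₂ s hs₃)) :=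
        wassersteinW1_map_triangle (hL.comp hφ₁) (hL.comp hφ₂) (hR.comp hψ₃) ν₁ ν₂ ν₃
    _ ≤ kernelDistWithin P₁ P₂ ℭ₁₂ hs₁ hs₂ ht₁ ht₂ (a, b) +
          kernelDistWithin P₂ P₃ ℭ₂₃ hs₂' hs₃ ht₂' ht₃ (b, c) := by
        refine add_le_add ?_ ?_
        · show _ ≤ wassersteinW1 (ν₁.map (ℭ₁₂.φ₁ s hs₁)) (ν₂.map (ℭ₁₂.φ₂ s hs₂))
          rw [← Measure.map_map hLm hφ₁.continuous.measurable,
            ← Measure.map_map hLm hφ₂.continuous.measurable]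
          exact wassersteinW1_map_le_of_edist_le hLm (fun x y ↦ (hL.edist_eq x y).le) _ _
        · show _ ≤ wassersteinW1 (ν₂.map (ℭ₂₃.φ₁ s hs₂')) (ν₃.map (ℭ₂₃.φ₂ s hs₃))
          rw [hmid, ← Measure.map_map hRm hψ₂.continuous.measurable,
            ← Measure.map_map hRm hψ₃.continuous.measurable]
          exact wassersteinW1_map_le_of_edist_le hRm (fun x y ↦ (hR.edist_eq x y).le) _ _

/-! ### Prop. 5.14: admissible radii add -/

/-- **Bamler 2023, Prop. 5.14 (arXiv v1 Prop. 113), in the glued correspondence**: if `r¹²` is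
admissible for `d^{ℭ¹²,J}_𝔽(𝒳¹, 𝒳²)` and `r²³` for `d^{ℭ²³,J}_𝔽(𝒳², 𝒳³)`, then `r¹² + r²³` is admissible
for `d^{ℭ¹².glue ℭ²³,J}_𝔽(𝒳¹, 𝒳³)`, for `H`-concentrated flows. As printed: `E¹³ := E¹² ∪ E²³`
(`|E¹³| ≤ (r¹²)² + (r²³)² ≤ (r¹² + r²³)²`), the couplings `q¹²_t`, `q²³_t` glue along `μ²_t` to `q¹²³_t`
(`IsCoupling.exists_glue` on the Polish slices) whose `(1, 3)`-marginal `q¹³_t` couples `μ¹_t, μ³_t`,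
and for `s ≤ t` the pointwise estimate `kernelDistWithin_glue_le` integrates to
`∫ d_{W₁}(…¹, …³) dq¹³_t ≤ ∫ d_{W₁}(…¹, …²) dq¹²_t + ∫ d_{W₁}(…², …³) dq²³_t ≤ r¹² + r²³`
(`measurable_kernelDistWithin`). [cite: Bamler2023, §5.2, Prop. 5.14 (arXiv v1 Prop. 113)] -/
theorem FDistAdmissible.trans {H₁ H₂ H₃ : ℝ} (hH₁ : P₁.flow.IsHConcentrated H₁)
    (hH₂ : P₂.flow.IsHConcentrated H₂) (hH₃ : P₃.flow.IsHConcentrated H₃)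
    {ℭ₁₂ : Correspondence₂ P₁.flow P₂.flow I''} {ℭ₂₃ : Correspondence₂ P₂.flow P₃.flow I''}
    {J : Set ℝ} {r₁₂ r₂₃ : ℝ} (h₁₂ : FDistAdmissible P₁ P₂ ℭ₁₂ J r₁₂)
    (h₂₃ : FDistAdmissible P₂ P₃ ℭ₂₃ J r₂₃) :
    FDistAdmissible P₁ P₃ (ℭ₁₂.glue ℭ₂₃) J (r₁₂ + r₂₃) := by
  obtain ⟨hr₁₂, E₁₂, hEm₁₂, hEI₁₂, hJ₁₂, hE₁, hE₂, hvol₁₂, q₁₂, hq₁₂, hint₁₂⟩ := h₁₂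
  obtain ⟨hr₂₃, E₂₃, hEm₂₃, hEI₂₃, hJ₂₃, hE₂', hE₃, hvol₂₃, q₂₃, hq₂₃, hint₂₃⟩ := h₂₃
  have hd₁₂ : I'' \ (E₁₂ ∪ E₂₃) ⊆ I'' \ E₁₂ := fun x hx ↦ ⟨hx.1, fun h ↦ hx.2 (Or.inl h)⟩
  have hd₂₃ : I'' \ (E₁₂ ∪ E₂₃) ⊆ I'' \ E₂₃ := fun x hx ↦ ⟨hx.1, fun h ↦ hx.2 (Or.inr h)⟩
  -- glue the couplings along `μ²_t`
  have hglue : ∀ t (ht : t ∈ I'' \ (E₁₂ ∪ E₂₃)),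
      ∃ γ : Measure (P₂.flow.Slice ⟨t, (ℭ₁₂.dom₂_subset (hE₂ (hd₁₂ ht))).1⟩ ×
        (P₁.flow.Slice ⟨t, (ℭ₁₂.dom₁_subset (hE₁ (hd₁₂ ht))).1⟩ ×
          P₃.flow.Slice ⟨t, (ℭ₂₃.dom₂_subset (hE₃ (hd₂₃ ht))).1⟩)),
        IsProbabilityMeasure γ ∧ γ.map (fun p ↦ (p.2.1, p.1)) = q₁₂ t (hd₁₂ ht) ∧
          γ.map (fun p ↦ (p.1, p.2.2)) = q₂₃ t (hd₂₃ ht) := fun t ht ↦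
    (hq₁₂ t (hd₁₂ ht)).exists_glue (hq₂₃ t (hd₂₃ ht))
  choose γ hγP hγ₁₂ hγ₂₃ using hglue
  have hvol : volume (E₁₂ ∪ E₂₃) ≤ ENNReal.ofReal ((r₁₂ + r₂₃) ^ 2) :=
    calc volume (E₁₂ ∪ E₂₃) ≤ volume E₁₂ + volume E₂₃ := measure_union_le _ _
      _ ≤ ENNReal.ofReal (r₁₂ ^ 2) + ENNReal.ofReal (r₂₃ ^ 2) := add_le_add hvol₁₂ hvol₂₃
      _ = ENNReal.ofReal (r₁₂ ^ 2 + r₂₃ ^ 2) :=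
          (ENNReal.ofReal_add (sq_nonneg _) (sq_nonneg _)).symm
      _ ≤ ENNReal.ofReal ((r₁₂ + r₂₃) ^ 2) :=
          ENNReal.ofReal_le_ofReal (by nlinarith [hr₁₂, hr₂₃])
  refine ⟨add_pos hr₁₂ hr₂₃, E₁₂ ∪ E₂₃, hEm₁₂.union hEm₂₃, union_subset hEI₁₂ hEI₂₃,
    fun x hx ↦ ⟨(hJ₁₂ hx).1, fun h ↦ h.elim (hJ₁₂ hx).2 (hJ₂₃ hx).2⟩,
    fun t ht ↦ hE₁ (hd₁₂ ht), fun t ht ↦ hE₃ (hd₂₃ ht), hvol, fun t ht ↦ (γ t ht).map Prod.snd,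
    fun t ht ↦ ?_, fun s hs t ht hst ↦ ?_⟩
  · -- the `(1, 3)`-marginal of the glued coupling couples `μ¹_t, μ³_t`
    haveI := hγP t ht
    have hc : IsCoupling (P₁.μ ⟨t, (ℭ₁₂.dom₁_subset (hE₁ (hd₁₂ ht))).1⟩)
        (P₃.μ ⟨t, (ℭ₂₃.dom₂_subset (hE₃ (hd₂₃ ht))).1⟩) ((γ t ht).map Prod.snd) := by
      refine ⟨Measure.isProbabilityMeasure_map measurable_snd.aemeasurable, ?_, ?_⟩
      · rw [Measure.fst, Measure.map_map measurable_fst measurable_snd,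
          ← (hq₁₂ t (hd₁₂ ht)).2.1, ← hγ₁₂ t ht, Measure.fst,
          Measure.map_map measurable_fst (measurable_snd.fst.prodMk measurable_fst)]
        rfl
      · rw [Measure.snd, Measure.map_map measurable_snd measurable_snd,
          ← (hq₂₃ t (hd₂₃ ht)).2.2, ← hγ₂₃ t ht, Measure.snd,
          Measure.map_map measurable_snd (measurable_fst.prodMk measurable_snd.snd)]
        rfl
    exact hc
  · -- the integral estimate for `s ≤ t`
    have hm₁₂ := measurable_kernelDistWithin hH₁ hH₂ ℭ₁₂ (hE₁ (hd₁₂ hs)) (hE₂ (hd₁₂ hs))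
      (hE₁ (hd₁₂ ht)) (hE₂ (hd₁₂ ht)) hst
    have hm₂₃ := measurable_kernelDistWithin hH₂ hH₃ ℭ₂₃ (hE₂' (hd₂₃ hs)) (hE₃ (hd₂₃ hs))
      (hE₂' (hd₂₃ ht)) (hE₃ (hd₂₃ ht)) hst
    have hP₁₂ : Measurable fun p : P₂.flow.Slice ⟨t, (ℭ₁₂.dom₂_subset (hE₂ (hd₁₂ ht))).1⟩ ×
        (P₁.flow.Slice ⟨t, (ℭ₁₂.dom₁_subset (hE₁ (hd₁₂ ht))).1⟩ ×
          P₃.flow.Slice ⟨t, (ℭ₂₃.dom₂_subset (hE₃ (hd₂₃ ht))).1⟩) ↦ (p.2.1, p.1) :=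
      measurable_snd.fst.prodMk measurable_fst
    have hP₂₃ : Measurable fun p : P₂.flow.Slice ⟨t, (ℭ₁₂.dom₂_subset (hE₂ (hd₁₂ ht))).1⟩ ×
        (P₁.flow.Slice ⟨t, (ℭ₁₂.dom₁_subset (hE₁ (hd₁₂ ht))).1⟩ ×
          P₃.flow.Slice ⟨t, (ℭ₂₃.dom₂_subset (hE₃ (hd₂₃ ht))).1⟩) ↦ (p.1, p.2.2) :=
      measurable_fst.prodMk measurable_snd.snd
    calc ∫⁻ p, kernelDistWithin P₁ P₃ (ℭ₁₂.glue ℭ₂₃) (hE₁ (hd₁₂ hs)) (hE₃ (hd₂₃ hs))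
          (hE₁ (hd₁₂ ht)) (hE₃ (hd₂₃ ht)) p ∂((γ t ht).map Prod.snd)
        ≤ ∫⁻ x, kernelDistWithin P₁ P₃ (ℭ₁₂.glue ℭ₂₃) (hE₁ (hd₁₂ hs)) (hE₃ (hd₂₃ hs))
            (hE₁ (hd₁₂ ht)) (hE₃ (hd₂₃ ht)) x.2 ∂(γ t ht) := lintegral_map_le _ _
      _ ≤ ∫⁻ x, (kernelDistWithin P₁ P₂ ℭ₁₂ (hE₁ (hd₁₂ hs)) (hE₂ (hd₁₂ hs)) (hE₁ (hd₁₂ ht))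
              (hE₂ (hd₁₂ ht)) (x.2.1, x.1) +
            kernelDistWithin P₂ P₃ ℭ₂₃ (hE₂' (hd₂₃ hs)) (hE₃ (hd₂₃ hs)) (hE₂' (hd₂₃ ht))
              (hE₃ (hd₂₃ ht)) (x.1, x.2.2)) ∂(γ t ht) :=
          lintegral_mono fun x ↦ kernelDistWithin_glue_le ℭ₁₂ ℭ₂₃ (hE₁ (hd₁₂ hs))
            (hE₂ (hd₁₂ hs)) (hE₂' (hd₂₃ hs)) (hE₃ (hd₂₃ hs)) (hE₁ (hd₁₂ ht)) (hE₂ (hd₁₂ ht))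
            (hE₂' (hd₂₃ ht)) (hE₃ (hd₂₃ ht)) hst x.2.1 x.1 x.2.2
      _ = ∫⁻ x, kernelDistWithin P₁ P₂ ℭ₁₂ (hE₁ (hd₁₂ hs)) (hE₂ (hd₁₂ hs)) (hE₁ (hd₁₂ ht))
              (hE₂ (hd₁₂ ht)) (x.2.1, x.1) ∂(γ t ht) +
            ∫⁻ x, kernelDistWithin P₂ P₃ ℭ₂₃ (hE₂' (hd₂₃ hs)) (hE₃ (hd₂₃ hs)) (hE₂' (hd₂₃ ht))
              (hE₃ (hd₂₃ ht)) (x.1, x.2.2) ∂(γ t ht) := lintegral_add_left (hm₁₂.comp hP₁₂) _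
      _ = ∫⁻ p, kernelDistWithin P₁ P₂ ℭ₁₂ (hE₁ (hd₁₂ hs)) (hE₂ (hd₁₂ hs)) (hE₁ (hd₁₂ ht))
              (hE₂ (hd₁₂ ht)) p ∂(q₁₂ t (hd₁₂ ht)) +
            ∫⁻ p, kernelDistWithin P₂ P₃ ℭ₂₃ (hE₂' (hd₂₃ hs)) (hE₃ (hd₂₃ hs)) (hE₂' (hd₂₃ ht))
              (hE₃ (hd₂₃ ht)) p ∂(q₂₃ t (hd₂₃ ht)) := by
          rw [← hγ₁₂ t ht, ← hγ₂₃ t ht, lintegral_map hm₁₂ hP₁₂, lintegral_map hm₂₃ hP₂₃]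
      _ ≤ ENNReal.ofReal r₁₂ + ENNReal.ofReal r₂₃ :=
          add_le_add (hint₁₂ s (hd₁₂ hs) t (hd₁₂ ht) hst) (hint₂₃ s (hd₂₃ hs) t (hd₂₃ ht) hst)
      _ = ENNReal.ofReal (r₁₂ + r₂₃) := (ENNReal.ofReal_add hr₁₂.le hr₂₃.le).symm

/-- `d^{ℭ¹².glue ℭ²³,J}_𝔽(𝒳¹, 𝒳³) ≤ d^{ℭ¹²,J}_𝔽(𝒳¹, 𝒳²) + d^{ℭ²³,J}_𝔽(𝒳², 𝒳³)` for `H`-concentrated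
flows (Prop. 5.14 at the level of the infima over admissible radii).
[cite: Bamler2023, §5.2, Prop. 5.14 (arXiv v1 Prop. 113)] -/
theorem fDistWithin_glue_le {H₁ H₂ H₃ : ℝ} (hH₁ : P₁.flow.IsHConcentrated H₁)
    (hH₂ : P₂.flow.IsHConcentrated H₂) (hH₃ : P₃.flow.IsHConcentrated H₃)
    (ℭ₁₂ : Correspondence₂ P₁.flow P₂.flow I'') (ℭ₂₃ : Correspondence₂ P₂.flow P₃.flow I'')
    (J : Set ℝ) :
    fDistWithin P₁ P₃ (ℭ₁₂.glue ℭ₂₃) J ≤ fDistWithin P₁ P₂ ℭ₁₂ J + fDistWithin P₂ P₃ ℭ₂₃ J := by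
  refine ENNReal.le_iInf_add_iInf fun r₁₂ r₂₃ ↦ ENNReal.le_iInf_add_iInf fun h₁₂ h₂₃ ↦ ?_
  rw [← ENNReal.ofReal_add h₁₂.1.le h₂₃.1.le]
  exact fDistWithin_le (h₁₂.trans hH₁ hH₂ hH₃ h₂₃)

/-- **Bamler 2023, Thm. 5.13 (arXiv v1 Thm. 112): the triangle inequality of the `𝔽`-distance**,
`d^J_𝔽(𝒳¹, 𝒳³) ≤ d^J_𝔽(𝒳¹, 𝒳²) + d^J_𝔽(𝒳², 𝒳³)` for `H`-concentrated metric flow pairs over a common `I`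
(in `[0, ∞]`): for correspondences `ℭ¹²`, `ℭ²³` over `I` fully defined over `J`, the glued
correspondence `ℭ¹².glue ℭ²³` (Lemma 5.15) is fully defined over `J` and
`d^J_𝔽(1, 3) ≤ d^{ℭ¹².glue ℭ²³,J}_𝔽(1, 3) ≤ d^{ℭ¹²,J}_𝔽(1, 2) + d^{ℭ²³,J}_𝔽(2, 3)` (Prop. 5.14,
`fDistWithin_glue_le`); take infima. The `H`-concentration (all flows of Bamler's compactness
theory are `H`-concentrated) makes the integrand Borel; see the module docstring.
[cite: Bamler2023, §5.2, Thm. 5.13 (arXiv v1 Thm. 112), Prop. 5.14, Lemma 5.15] -/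
theorem fDist_triangle {I J : Set ℝ} (P₁ P₂ P₃ : MetricFlowPair.{u} I)
    (h₁ : ∃ H, P₁.flow.IsHConcentrated H) (h₂ : ∃ H, P₂.flow.IsHConcentrated H)
    (h₃ : ∃ H, P₃.flow.IsHConcentrated H) :
    fDist J P₁ P₃ ≤ fDist J P₁ P₂ + fDist J P₂ P₃ := by
  obtain ⟨H₁, hH₁⟩ := h₁
  obtain ⟨H₂, hH₂⟩ := h₂
  obtain ⟨H₃, hH₃⟩ := h₃
  refine ENNReal.le_iInf_add_iInf fun ℭ₁₂ ℭ₂₃ ↦ ENNReal.le_iInf_add_iInf fun h₁₂ h₂₃ ↦ ?_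
  exact (fDist_le_fDistWithin (ℭ₁₂.glue ℭ₂₃)
    (Correspondence₂.FullyDefinedOver.glue ℭ₁₂ ℭ₂₃ h₁₂ h₂₃)).trans
      (fDistWithin_glue_le hH₁ hH₂ hH₃ ℭ₁₂ ℭ₂₃ J)

end MetricFlowPair

end Literature.Geometry.Riemannian

end
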